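import Summits.HubbardSuperconductivity.HubbardSuperconductivity.Theorems.TwSeededEnsembleEquivalence.Negative.BetaMonotonicity

/-!
# The T = 0 normal form (Template C) of crux `TwSeededEnsembleEquivalence`
# (stmt-HubbardSuperconductivity-1698)

Negative-side support lemmas (refuter, cdisprove gen 3), all sorry-free and definition-free
(statements written out over tree declarations so that planners / provers can import them):

* `twSeededEnsembleEquivalence_hullTouchT0` — crux ⇒ weak T = 0 hull touch (`∀ κ ∃ μ`);
* `seeded_hullTouchT0Strong_of_hullTouchT0` — compactness upgrade to ONE slope `μ` (`∃ μ ∀ κ`);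
* `twSeededEnsembleEquivalence_iff_hullTouchT0Strong` — the crux is EQUIVALENT to its T = 0
  supporting-slope statement (β, ε and the partition function eliminated);
* `twSeededEnsembleEquivalence_false_of_hullGapT0` — kill form: an asymptotic T = 0 hull gap at
  density `1 − δ` of the seeded model refutes the crux (and nothing else can).

See `Cruxes/TwSeededEnsembleEquivalence/Disproof.lean` (gen 3) for the analysis these serve.
-/

namespace Summit.HubbardSuperconductivity.HubbardSuperconductivity.Theorems.TwSeededEnsembleEquivalence.Negative

open Matrix Literature.MathematicalPhysics.QuantumLattice
open Summit.HubbardSuperconductivity.HubbardSuperconductivity.Theses.ThermalWedge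
open scoped ComplexOrder
open Filter Topology

noncomputable section

/-! ### Template C — the T = 0 normal form -/

/-- `N_L = 2⌊(1−δ)L²/2⌋₊ ≤ L²` in the crux's cast form. -/
theorem two_mul_floor_le_sq (δ : ℝ) (hδ : δ ∈ Set.Icc (1/10 : ℝ) (2/5 : ℝ)) (L : ℕ) :
    2 * (⌊(1 - δ) * (L : ℝ) ^ 2 / 2⌋₊ : ℝ) ≤ (L : ℝ) ^ 2 := by
  have h1 : (⌊(1 - δ) * (L : ℝ) ^ 2 / 2⌋₊ : ℝ) ≤ (1 - δ) * (L : ℝ) ^ 2 / 2 := by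
    apply Nat.floor_le
    have : 0 ≤ (1 - δ) := by linarith [hδ.2]
    positivity
  have hL : (0 : ℝ) ≤ (L : ℝ) ^ 2 := sq_nonneg _
  nlinarith [hδ.1]

/-- **crux ⇒ weak T = 0 hull touch** (`∀ κ ∃ μ`): for every admissible `(U, g)` and `κ > 0` some
`μ` in the window has `E_{N_L} − μ N_L ≤ E₀(H_can − μN̂) + κ L²` eventually in `L`
(`β := max 1 (2 log 4/κ)`, `ε := κ/2`, `Z ≥ e^{−βE₀}`). -/
theorem twSeededEnsembleEquivalence_hullTouchT0 (h : TwSeededEnsembleEquivalence) :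
    ∀ δ ∈ Set.Icc (1/10 : ℝ) (2/5 : ℝ), ∃ μ₁ μ₂ : ℝ, -4 < μ₁ ∧ μ₁ ≤ μ₂ ∧ μ₂ < 0 ∧ ∃ U₀ : ℝ, 0 < U₀ ∧
      ∀ U ∈ Set.Ioc (0 : ℝ) U₀, ∀ g ∈ Set.Ioc (0 : ℝ) (1 / 10), ∀ κ : ℝ, 0 < κ →
        ∃ μ ∈ Set.Icc μ₁ μ₂, ∃ L₀ : ℕ, ∀ (L : ℕ) [NeZero L], L₀ ≤ L →
          (hubbardTorus 2 L 1 U - ((g / (L : ℝ) ^ 2 : ℝ) : ℂ) •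
              ((pairField dWaveFormFactor L)ᴴ * pairField dWaveFormFactor L)).minEnergyOn
              (szSector (Λ := FermionTorus 2 L) (2 * ⌊(1 - δ) * (L : ℝ) ^ 2 / 2⌋₊) 0) -
              μ * (2 * (⌊(1 - δ) * (L : ℝ) ^ 2 / 2⌋₊ : ℝ)) ≤
            (hubbardTorusWith 2 L 1 U μ - ((g / (L : ℝ) ^ 2 : ℝ) : ℂ) •
              ((pairField dWaveFormFactor L)ᴴ * pairField dWaveFormFactor L)).groundEnergy +
              κ * (L : ℝ) ^ 2 := by
  intro δ hδ
  obtain ⟨μ₁, μ₂, hμ₁, hμ₁₂, hμ₂, U₀, hU₀, hU⟩ := h δ hδ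
  refine ⟨μ₁, μ₂, hμ₁, hμ₁₂, hμ₂, U₀, hU₀, fun U hUm g hg κ hκ => ?_⟩
  set β : ℝ := max 1 (2 * Real.log 4 / κ) with hβdef
  have hβ1 : 1 ≤ β := le_max_left _ _
  have hβpos : 0 < β := lt_of_lt_of_le one_pos hβ1
  have hlog4 : 0 < Real.log 4 := Real.log_pos (by norm_num)
  have hslack : Real.log 4 / β ≤ κ / 2 := by
    rw [div_le_iff₀ hβpos]
    have : 2 * Real.log 4 / κ ≤ β := le_max_right _ _
    rw [div_le_iff₀ hκ] at this
    linarith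
  obtain ⟨μ, hμm, hμ⟩ := hU U hUm g hg β hβ1
  obtain ⟨L₀, hL₀⟩ := hμ (κ / 2) (by linarith)
  refine ⟨μ, hμm, L₀, fun L _ hL => ?_⟩
  have hcrux := hL₀ L hL
  have hLpos : (0 : ℝ) < (L : ℝ) ^ 2 := cast_sq_pos_of_neZero L
  have hL0 : (L : ℝ) ≠ 0 := fun h0 => by rw [h0] at hLpos; simp at hLpos
  set Z := Real.log ((hubbardTorusWith 2 L 1 U μ - ((g / (L : ℝ) ^ 2 : ℝ) : ℂ) •
      ((pairField dWaveFormFactor L)ᴴ * pairField dWaveFormFactor L)).partitionFn β).re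
  set A := (hubbardTorus 2 L 1 U - ((g / (L : ℝ) ^ 2 : ℝ) : ℂ) •
      ((pairField dWaveFormFactor L)ᴴ * pairField dWaveFormFactor L)).minEnergyOn
      (szSector (Λ := FermionTorus 2 L) (2 * ⌊(1 - δ) * (L : ℝ) ^ 2 / 2⌋₊) 0)
  set E₀ := (hubbardTorusWith 2 L 1 U μ - ((g / (L : ℝ) ^ 2 : ℝ) : ℂ) •
      ((pairField dWaveFormFactor L)ᴴ * pairField dWaveFormFactor L)).groundEnergy
  set ν := 2 * (⌊(1 - δ) * (L : ℝ) ^ 2 / 2⌋₊ : ℝ)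
  have hZ : -(β * E₀) ≤ Z := neg_mul_groundEnergy_le_log_partitionFn (isHermitian_seededGC L U μ g) β
  have hZ' : -(E₀ / (L : ℝ) ^ 2) ≤ Z / (β * (L : ℝ) ^ 2) := by
    rw [le_div_iff₀ (mul_pos hβpos hLpos)]
    have : -(E₀ / (L : ℝ) ^ 2) * (β * (L : ℝ) ^ 2) = -(β * E₀) := by
      field_simp
    linarith
  have hmain : A / (L : ℝ) ^ 2 - E₀ / (L : ℝ) ^ 2 - μ * ν / (L : ℝ) ^ 2 ≤ κ := by linarith
  have : (A - E₀ - μ * ν) / (L : ℝ) ^ 2 ≤ κ := by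
    rw [sub_div, sub_div]; exact hmain
  rw [div_le_iff₀ hLpos] at this
  linarith

/-- **Compactness upgrade: weak hull touch ⇒ strong hull touch** at fixed `(δ, window, U, g)`:
`∀ κ ∃ μ ∈ [μ₁,μ₂]` eventually-in-`L` bounds upgrade to ONE `μ ∈ [μ₁,μ₂]` serving every `κ`
(Bolzano–Weierstrass in the compact window, the `2L²`-Lipschitz bound in `μ`, `N_L ≤ L²`). -/
theorem seeded_hullTouchT0Strong_of_hullTouchT0 {δ μ₁ μ₂ U g : ℝ}
    (hδ : δ ∈ Set.Icc (1/10 : ℝ) (2/5 : ℝ))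
    (hw : ∀ κ : ℝ, 0 < κ → ∃ μ ∈ Set.Icc μ₁ μ₂, ∃ L₀ : ℕ, ∀ (L : ℕ) [NeZero L], L₀ ≤ L →
      (hubbardTorus 2 L 1 U - ((g / (L : ℝ) ^ 2 : ℝ) : ℂ) •
          ((pairField dWaveFormFactor L)ᴴ * pairField dWaveFormFactor L)).minEnergyOn
          (szSector (Λ := FermionTorus 2 L) (2 * ⌊(1 - δ) * (L : ℝ) ^ 2 / 2⌋₊) 0) -
          μ * (2 * (⌊(1 - δ) * (L : ℝ) ^ 2 / 2⌋₊ : ℝ)) ≤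
        (hubbardTorusWith 2 L 1 U μ - ((g / (L : ℝ) ^ 2 : ℝ) : ℂ) •
          ((pairField dWaveFormFactor L)ᴴ * pairField dWaveFormFactor L)).groundEnergy +
          κ * (L : ℝ) ^ 2) :
    ∃ μ ∈ Set.Icc μ₁ μ₂, ∀ κ : ℝ, 0 < κ → ∃ L₀ : ℕ, ∀ (L : ℕ) [NeZero L], L₀ ≤ L →
      (hubbardTorus 2 L 1 U - ((g / (L : ℝ) ^ 2 : ℝ) : ℂ) •
          ((pairField dWaveFormFactor L)ᴴ * pairField dWaveFormFactor L)).minEnergyOn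
          (szSector (Λ := FermionTorus 2 L) (2 * ⌊(1 - δ) * (L : ℝ) ^ 2 / 2⌋₊) 0) -
          μ * (2 * (⌊(1 - δ) * (L : ℝ) ^ 2 / 2⌋₊ : ℝ)) ≤
        (hubbardTorusWith 2 L 1 U μ - ((g / (L : ℝ) ^ 2 : ℝ) : ℂ) •
          ((pairField dWaveFormFactor L)ᴴ * pairField dWaveFormFactor L)).groundEnergy +
          κ * (L : ℝ) ^ 2 := by
  have hseq : ∀ n : ℕ, ∃ μ ∈ Set.Icc μ₁ μ₂, ∃ L₀ : ℕ, ∀ (L : ℕ) [NeZero L], L₀ ≤ L →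
      (hubbardTorus 2 L 1 U - ((g / (L : ℝ) ^ 2 : ℝ) : ℂ) •
          ((pairField dWaveFormFactor L)ᴴ * pairField dWaveFormFactor L)).minEnergyOn
          (szSector (Λ := FermionTorus 2 L) (2 * ⌊(1 - δ) * (L : ℝ) ^ 2 / 2⌋₊) 0) -
          μ * (2 * (⌊(1 - δ) * (L : ℝ) ^ 2 / 2⌋₊ : ℝ)) ≤
        (hubbardTorusWith 2 L 1 U μ - ((g / (L : ℝ) ^ 2 : ℝ) : ℂ) •
          ((pairField dWaveFormFactor L)ᴴ * pairField dWaveFormFactor L)).groundEnergy +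
          (1 / ((n : ℝ) + 1)) * (L : ℝ) ^ 2 :=
    fun n => hw (1 / ((n : ℝ) + 1)) (by positivity)
  choose μs hμs L₀ hL₀ using hseq
  obtain ⟨μ, hμm, φ, hφ, hlim⟩ := isCompact_Icc.tendsto_subseq hμs
  refine ⟨μ, hμm, fun κ hκ => ?_⟩
  obtain ⟨N₁, hN₁⟩ := Metric.tendsto_atTop.1 hlim (κ / 6) (by positivity)
  obtain ⟨N₂, hN₂⟩ := exists_nat_gt (2 / κ)
  set n := max N₁ N₂ with hn
  have hdist : dist (μs (φ n)) μ < κ / 6 := hN₁ n (le_max_left _ _)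
  have hφn : (N₂ : ℝ) ≤ (φ n : ℝ) := by
    have : N₂ ≤ φ n := (le_max_right _ _).trans (hφ.id_le n)
    exact_mod_cast this
  have hsmall : 1 / ((φ n : ℝ) + 1) ≤ κ / 2 := by
    rw [div_le_div_iff₀ (by positivity) (by positivity)]
    have : 2 / κ < (φ n : ℝ) + 1 := by linarith
    rw [div_lt_iff₀ hκ] at this
    linarith
  refine ⟨L₀ (φ n), fun L _ hL => ?_⟩
  have hT := hL₀ (φ n) L hL
  have hLip := abs_groundEnergy_seededGC_sub_le L U g (μs (φ n)) μ
  have hNL := two_mul_floor_le_sq δ hδ L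
  have hNL0 : (0 : ℝ) ≤ 2 * (⌊(1 - δ) * (L : ℝ) ^ 2 / 2⌋₊ : ℝ) := by positivity
  have hL2 : (0 : ℝ) ≤ (L : ℝ) ^ 2 := sq_nonneg _
  have hd : |μs (φ n) - μ| < κ / 6 := by rwa [Real.dist_eq] at hdist
  rw [abs_lt] at hd
  rw [abs_le] at hLip
  set ν := 2 * (⌊(1 - δ) * (L : ℝ) ^ 2 / 2⌋₊ : ℝ)
  have h1 : (μs (φ n) - μ) * ν ≤ κ / 6 * (L : ℝ) ^ 2 := by
    calc (μs (φ n) - μ) * ν ≤ (κ / 6) * ν := mul_le_mul_of_nonneg_right hd.2.le hNL0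
      _ ≤ κ / 6 * (L : ℝ) ^ 2 := mul_le_mul_of_nonneg_left hNL (by positivity)
  have h2 : 2 * (L : ℝ) ^ 2 * |μs (φ n) - μ| ≤ 2 * (L : ℝ) ^ 2 * (κ / 6) := by
    refine mul_le_mul_of_nonneg_left ?_ (by positivity)
    rw [abs_le]; constructor <;> linarith
  have h3 : 1 / ((φ n : ℝ) + 1) * (L : ℝ) ^ 2 ≤ κ / 2 * (L : ℝ) ^ 2 :=
    mul_le_mul_of_nonneg_right hsmall hL2
  nlinarith [hLip.1, hLip.2, h1, h2, h3, hT]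

/-- **Template C — the T = 0 normal form of the crux.** `TwSeededEnsembleEquivalence` is
EQUIVALENT to the strong hull-touch statement: for every `δ` in the window there are a window
`[μ₁, μ₂] ⊂ (−4, 0)` and `U₀ > 0` such that for all admissible `(U, g)` ONE slope `μ ∈ [μ₁, μ₂]`
asymptotically supports the seeded sector staircase at `N_L`:
`E_{N_L}(U,g) − μ N_L ≤ E₀(H_can(U,g) − μN̂) + κ L²` for every `κ > 0`, eventually in `L`.
(⇒: weak form + compactness upgrade; ⇐: `Z ≤ 4^{L²} e^{−βE₀}`, the same `μ` for every `β ≥ 1`.)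
Inverse temperature, `ε` and the partition function are eliminated. -/
theorem twSeededEnsembleEquivalence_iff_hullTouchT0Strong :
    TwSeededEnsembleEquivalence ↔
      ∀ δ ∈ Set.Icc (1/10 : ℝ) (2/5 : ℝ), ∃ μ₁ μ₂ : ℝ, -4 < μ₁ ∧ μ₁ ≤ μ₂ ∧ μ₂ < 0 ∧
        ∃ U₀ : ℝ, 0 < U₀ ∧ ∀ U ∈ Set.Ioc (0 : ℝ) U₀, ∀ g ∈ Set.Ioc (0 : ℝ) (1 / 10),
          ∃ μ ∈ Set.Icc μ₁ μ₂, ∀ κ : ℝ, 0 < κ → ∃ L₀ : ℕ, ∀ (L : ℕ) [NeZero L], L₀ ≤ L →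
            (hubbardTorus 2 L 1 U - ((g / (L : ℝ) ^ 2 : ℝ) : ℂ) •
                ((pairField dWaveFormFactor L)ᴴ * pairField dWaveFormFactor L)).minEnergyOn
                (szSector (Λ := FermionTorus 2 L) (2 * ⌊(1 - δ) * (L : ℝ) ^ 2 / 2⌋₊) 0) -
                μ * (2 * (⌊(1 - δ) * (L : ℝ) ^ 2 / 2⌋₊ : ℝ)) ≤
              (hubbardTorusWith 2 L 1 U μ - ((g / (L : ℝ) ^ 2 : ℝ) : ℂ) •
                ((pairField dWaveFormFactor L)ᴴ * pairField dWaveFormFactor L)).groundEnergy +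
                κ * (L : ℝ) ^ 2 := by
  constructor
  · intro h δ hδ
    obtain ⟨μ₁, μ₂, hμ₁, hμ₁₂, hμ₂, U₀, hU₀, hU⟩ := twSeededEnsembleEquivalence_hullTouchT0 h δ hδ
    exact ⟨μ₁, μ₂, hμ₁, hμ₁₂, hμ₂, U₀, hU₀, fun U hUm g hg =>
      seeded_hullTouchT0Strong_of_hullTouchT0 hδ (hU U hUm g hg)⟩
  · intro h δ hδ
    obtain ⟨μ₁, μ₂, hμ₁, hμ₁₂, hμ₂, U₀, hU₀, hU⟩ := h δ hδ
    refine ⟨μ₁, μ₂, hμ₁, hμ₁₂, hμ₂, U₀, hU₀, fun U hUm g hg β hβ1 => ?_⟩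
    obtain ⟨μ, hμm, hμ⟩ := hU U hUm g hg
    refine ⟨μ, hμm, fun ε hε => ?_⟩
    obtain ⟨L₀, hL₀⟩ := hμ ε hε
    refine ⟨L₀, fun L _ hL => ?_⟩
    have hT := hL₀ L hL
    have hβpos : 0 < β := lt_of_lt_of_le one_pos hβ1
    have hLpos : (0 : ℝ) < (L : ℝ) ^ 2 := cast_sq_pos_of_neZero L
    have hL0 : (L : ℝ) ≠ 0 := fun h0 => by rw [h0] at hLpos; simp at hLpos
    set Z := Real.log ((hubbardTorusWith 2 L 1 U μ - ((g / (L : ℝ) ^ 2 : ℝ) : ℂ) •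
        ((pairField dWaveFormFactor L)ᴴ * pairField dWaveFormFactor L)).partitionFn β).re
    set A := (hubbardTorus 2 L 1 U - ((g / (L : ℝ) ^ 2 : ℝ) : ℂ) •
        ((pairField dWaveFormFactor L)ᴴ * pairField dWaveFormFactor L)).minEnergyOn
        (szSector (Λ := FermionTorus 2 L) (2 * ⌊(1 - δ) * (L : ℝ) ^ 2 / 2⌋₊) 0)
    set E₀ := (hubbardTorusWith 2 L 1 U μ - ((g / (L : ℝ) ^ 2 : ℝ) : ℂ) •
        ((pairField dWaveFormFactor L)ᴴ * pairField dWaveFormFactor L)).groundEnergy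
    set ν := 2 * (⌊(1 - δ) * (L : ℝ) ^ 2 / 2⌋₊ : ℝ)
    have hZ : Z ≤ (L : ℝ) ^ 2 * Real.log 4 - β * E₀ := by
      have := log_partitionFn_le_log_card_sub (isHermitian_seededGC L U μ g) hβpos.le
      rwa [log_card_fock] at this
    have hZ' : Z / (β * (L : ℝ) ^ 2) ≤ Real.log 4 / β - E₀ / (L : ℝ) ^ 2 := by
      rw [div_le_iff₀ (mul_pos hβpos hLpos)]
      have : (Real.log 4 / β - E₀ / (L : ℝ) ^ 2) * (β * (L : ℝ) ^ 2) =
          (L : ℝ) ^ 2 * Real.log 4 - β * E₀ := by field_simp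
      linarith
    have hE : E₀ / (L : ℝ) ^ 2 ≥ (A - μ * ν) / (L : ℝ) ^ 2 - ε := by
      have h1 : (A - μ * ν) / (L : ℝ) ^ 2 ≤ (E₀ + ε * (L : ℝ) ^ 2) / (L : ℝ) ^ 2 :=
        div_le_div_of_nonneg_right hT hLpos.le
      have h2 : (E₀ + ε * (L : ℝ) ^ 2) / (L : ℝ) ^ 2 = E₀ / (L : ℝ) ^ 2 + ε := by
        field_simp
      linarith
    have h3 : (A - μ * ν) / (L : ℝ) ^ 2 = A / (L : ℝ) ^ 2 - μ * ν / (L : ℝ) ^ 2 := by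
      rw [sub_div]
    linarith

/-- **Template C, kill form.** An asymptotic T = 0 HULL GAP refutes the crux: some `δ` in the
window such that for EVERY candidate window `[μ₁, μ₂] ⊂ (−4, 0)` and every `U₀ > 0` there are
admissible `U ≤ U₀`, `g ≤ 1/10` for which every slope `μ ∈ [μ₁, μ₂]` misses the `N_L` sector by a
macroscopic margin along a subsequence of `L`:
`E₀(H_can(U,g) − μN̂) + κ L² < E_{N_L}(U,g) − μ N_L`. By
`twSeededEnsembleEquivalence_iff_hullTouchT0Strong` this is also NECESSARY: it is the complete
description of a disproof. -/
theorem twSeededEnsembleEquivalence_false_of_hullGapT0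
    (hgap : ∃ δ ∈ Set.Icc (1/10 : ℝ) (2/5 : ℝ), ∀ μ₁ μ₂ : ℝ, -4 < μ₁ → μ₁ ≤ μ₂ → μ₂ < 0 →
      ∀ U₀ : ℝ, 0 < U₀ → ∃ U ∈ Set.Ioc (0 : ℝ) U₀, ∃ g ∈ Set.Ioc (0 : ℝ) (1 / 10),
        ∀ μ ∈ Set.Icc μ₁ μ₂, ∃ κ : ℝ, 0 < κ ∧ ∀ L₀ : ℕ, ∃ (L : ℕ) (_ : NeZero L), L₀ ≤ L ∧
          (hubbardTorusWith 2 L 1 U μ - ((g / (L : ℝ) ^ 2 : ℝ) : ℂ) •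
              ((pairField dWaveFormFactor L)ᴴ * pairField dWaveFormFactor L)).groundEnergy +
              κ * (L : ℝ) ^ 2 <
            (hubbardTorus 2 L 1 U - ((g / (L : ℝ) ^ 2 : ℝ) : ℂ) •
              ((pairField dWaveFormFactor L)ᴴ * pairField dWaveFormFactor L)).minEnergyOn
              (szSector (Λ := FermionTorus 2 L) (2 * ⌊(1 - δ) * (L : ℝ) ^ 2 / 2⌋₊) 0) -
              μ * (2 * (⌊(1 - δ) * (L : ℝ) ^ 2 / 2⌋₊ : ℝ))) :
    ¬ TwSeededEnsembleEquivalence := by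
  intro h
  obtain ⟨δ, hδ, hbad⟩ := hgap
  obtain ⟨μ₁, μ₂, hμ₁, hμ₁₂, hμ₂, U₀, hU₀, hgood⟩ :=
    (twSeededEnsembleEquivalence_iff_hullTouchT0Strong.1 h) δ hδ
  obtain ⟨U, hU, g, hg, hμ⟩ := hbad μ₁ μ₂ hμ₁ hμ₁₂ hμ₂ U₀ hU₀
  obtain ⟨μ, hμm, hT⟩ := hgood U hU g hg
  obtain ⟨κ, hκ, hL⟩ := hμ μ hμm
  obtain ⟨L₀, hL₀⟩ := hT κ hκ
  obtain ⟨L, hLnz, hLle, hlt⟩ := hL L₀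
  have := hL₀ L hLle
  linarith

end

end Summit.HubbardSuperconductivity.HubbardSuperconductivity.Theorems.TwSeededEnsembleEquivalence.Negative
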